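import Summits.Ventures.Crystal3D.Theorems.StickyWulffConstantPolycrystalWulffBoundPerSelf

/-!
# `PolycrystalWulffBound`: VERTEX SHAVING of the Wulff body — `|W_A ∖ B̄(0, √(5−ε))| ≤ 8ε³`

Route `StickyWulffConstant` of the venture `Summits/Ventures/Crystal3D`, crux `PolycrystalWulffBound`
(item `stmt-Ventures-19482`), second prover lane (poly-p2, gen 4).  A cheap quantitative form of the
stability of the Wulff crystal's facet directions for the middle-band LP of line `PolyDensity`
(HOME/poly-p2/MIDDLE-BAND-g4.md §3): a block body `K ⊆ W(A f)` of `block_wulff_le_freeEnergy` may be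
replaced by `K ∩ B̄(0, √(5−ε))`, lowering the interface charge from `√5` (a VERTEX direction of the
truncated octahedron) to `√(5−ε)` at the price of at most `8ε³` of volume:
`volume_truncOct_normSq_gt_le` (cubic frame), `volume_cruxWulffBody_diff_closedBall_le` (any `A`),
`toReal_volume_inter_closedBall_ge` (`|K| − 8ε³ ≤ |K ∩ B̄|` for `K ⊆ W(A)`).
Proof: `‖y‖² > 5 − ε` on `W` forces `2a + b > 5 − ε` for the two largest `|y_i|` (`a² + b² + c² ≤ 2a + b`
on `{0 ≤ c ≤ b ≤ a ≤ 2, a+b+c ≤ 3}`), so the shell is covered by `24` corners, each an affine image with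
Jacobian `ε³` of a quarter of the unit `ℓ¹`-ball (volume `≤ 1/3`).
WHAT THIS IS NOT: a rung; the exact shell volume (spherical caps) is not computed; F-C1 not moved.
-/

noncomputable section

namespace Summit.Ventures.Crystal3D.Theorems

open MeasureTheory MeasureTheory.Measure Set Metric
open scoped RealInnerProductSpace ENNReal Pointwise
open Literature.MathematicalPhysics.StatisticalMechanics

/-! ### Step 1: a quarter of the unit `ℓ¹`-ball of `Fin 3 → ℝ` has volume `≤ 1/3` -/
/-- Volume of the `ℓ¹`-ball of radius `r` in `Fin 3 → ℝ`: `(4/3)·r³`. -/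
theorem volume_l1Ball_fin_three (r : ℝ) :
    volume {f : Fin 3 → ℝ | ∑ i, |f i| ≤ r} = ENNReal.ofReal r ^ 3 * ENNReal.ofReal (4 / 3) := by
  have h := MeasureTheory.volume_sum_rpow_le (ι := Fin 3) (p := 1) le_rfl r
  simp only [Real.rpow_one, div_one, Fintype.card_fin] at h
  rw [show (1 : ℝ) + 1 = 2 by norm_num, Real.Gamma_two, Real.Gamma_nat_eq_factorial 3] at h
  rw [h]
  norm_num [Nat.factorial]

/-- The `ℓ¹`-sum of a point of `Fin 3 → ℝ` is measurable. -/
theorem measurable_sum_abs_fin_three : Measurable fun w : Fin 3 → ℝ => ∑ j, |w j| :=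
  Finset.measurable_sum _ fun j _ => (continuous_apply j).abs.measurable

/-- The open quarter `{0 < s₀ w₀, 0 < s₁ w₁, Σ|w_j| ≤ 1}` of the unit `ℓ¹`-ball is measurable. -/
theorem measurableSet_quarterBall (s₀ s₁ : ℝ) :
    MeasurableSet {w : Fin 3 → ℝ | 0 < s₀ * w 0 ∧ 0 < s₁ * w 1 ∧ ∑ j, |w j| ≤ 1} := by
  rw [Set.setOf_and, Set.setOf_and]
  exact (measurableSet_lt measurable_const ((measurable_pi_apply 0).const_mul s₀)).inter
    ((measurableSet_lt measurable_const ((measurable_pi_apply 1).const_mul s₁)).inter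
      (measurableSet_le measurable_sum_abs_fin_three measurable_const))

/-- The four open quarters `{0 < ±w₀, 0 < ±w₁, Σ|w_j| ≤ 1}` have the same volume as the positive one
(coordinate reflections have determinant `±1`). -/
theorem volume_quarterBall_eq {s₀ s₁ : ℝ} (hs₀ : s₀ = 1 ∨ s₀ = -1) (hs₁ : s₁ = 1 ∨ s₁ = -1) :
    volume {w : Fin 3 → ℝ | 0 < s₀ * w 0 ∧ 0 < s₁ * w 1 ∧ ∑ j, |w j| ≤ 1} =
      volume {w : Fin 3 → ℝ | 0 < 1 * w 0 ∧ 0 < 1 * w 1 ∧ ∑ j, |w j| ≤ 1} := by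
  set d : Fin 3 → ℝ := ![s₀, s₁, 1] with hd
  have hd0 : d 0 = s₀ := rfl; have hd1 : d 1 = s₁ := rfl; have hd2 : d 2 = 1 := rfl
  have habs : ∀ j, |d j| = 1 := by
    intro j
    fin_cases j
    · show |d 0| = 1; rw [hd0]; rcases hs₀ with h | h <;> rw [h] <;> norm_num
    · show |d 1| = 1; rw [hd1]; rcases hs₁ with h | h <;> rw [h] <;> norm_num
    · show |d 2| = 1; rw [hd2]; norm_num
  set D : (Fin 3 → ℝ) →ₗ[ℝ] (Fin 3 → ℝ) := Matrix.toLin' (Matrix.diagonal d) with hD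
  have hDapp : ∀ w j, D w j = d j * w j := by
    intro w j
    rw [hD, Matrix.toLin'_apply, Matrix.mulVec_diagonal]
  have hdet : LinearMap.det D = s₀ * s₁ := by
    rw [hD, LinearMap.det_toLin', Matrix.det_diagonal, Fin.prod_univ_three, hd0, hd1, hd2, mul_one]
  have hdet1 : |LinearMap.det D| = 1 := by
    rw [hdet, abs_mul]
    rcases hs₀ with h | h <;> rcases hs₁ with h' | h' <;> rw [h, h'] <;> norm_num
  have hdet0 : LinearMap.det D ≠ 0 := fun h => by rw [h, abs_zero] at hdet1; exact zero_ne_one hdet1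
  have hpre : {w : Fin 3 → ℝ | 0 < s₀ * w 0 ∧ 0 < s₁ * w 1 ∧ ∑ j, |w j| ≤ 1} =
      D ⁻¹' {w : Fin 3 → ℝ | 0 < 1 * w 0 ∧ 0 < 1 * w 1 ∧ ∑ j, |w j| ≤ 1} := by
    ext w
    simp only [Set.mem_setOf_eq, Set.mem_preimage, hDapp, hd0, hd1, one_mul, abs_mul, habs]
  rw [hpre, addHaar_preimage_linearMap volume hdet0, abs_inv, hdet1, inv_one, ENNReal.ofReal_one,
    one_mul]

/-- **A quarter of the unit `ℓ¹`-ball has volume `≤ 1/3`**: the four open quarters are pairwise disjoint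
inside the ball (volume `4/3`) and have equal volumes; the closed quarter differs from the open one by
the null hyperplane `{w₀ = 0}`. -/
theorem volume_quarterBall_le :
    volume {w : Fin 3 → ℝ | 0 ≤ w 0 ∧ 0 < w 1 ∧ ∑ j, |w j| ≤ 1} ≤ ENNReal.ofReal (1 / 3) := by
  set Q : ℝ → ℝ → Set (Fin 3 → ℝ) := fun s₀ s₁ =>
    {w | 0 < s₀ * w 0 ∧ 0 < s₁ * w 1 ∧ ∑ j, |w j| ≤ 1} with hQ
  -- the open positive quarter has volume ≤ 1/3
  have hopen : volume (Q 1 1) ≤ ENNReal.ofReal (1 / 3) := by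
    have hsub : Q 1 1 ∪ Q 1 (-1) ∪ (Q (-1) 1 ∪ Q (-1) (-1)) ⊆ {f : Fin 3 → ℝ | ∑ j, |f j| ≤ 1} := by
      rintro w ((⟨-, -, h⟩ | ⟨-, -, h⟩) | (⟨-, -, h⟩ | ⟨-, -, h⟩)) <;> exact h
    have hd1 : Disjoint (Q 1 1) (Q 1 (-1)) := by
      rw [Set.disjoint_left]; rintro w ⟨-, h1, -⟩ ⟨-, h2, -⟩; rw [neg_mul] at h2; linarith
    have hd2 : Disjoint (Q (-1) 1) (Q (-1) (-1)) := by
      rw [Set.disjoint_left]; rintro w ⟨-, h1, -⟩ ⟨-, h2, -⟩; rw [neg_mul] at h2; linarith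
    have hd3 : Disjoint (Q 1 1 ∪ Q 1 (-1)) (Q (-1) 1 ∪ Q (-1) (-1)) := by
      rw [Set.disjoint_left]
      rintro w (⟨h1, -, -⟩ | ⟨h1, -, -⟩) (⟨h2, -, -⟩ | ⟨h2, -, -⟩) <;> rw [neg_mul] at h2 <;> linarith
    have hvol := measure_mono (μ := volume) hsub
    rw [volume_l1Ball_fin_three 1, ENNReal.ofReal_one, one_pow, one_mul,
      measure_union hd3 ((measurableSet_quarterBall _ _).union (measurableSet_quarterBall _ _)),
      measure_union hd1 (measurableSet_quarterBall _ _),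
      measure_union hd2 (measurableSet_quarterBall _ _),
      volume_quarterBall_eq (Or.inl rfl) (Or.inr rfl), volume_quarterBall_eq (Or.inr rfl) (Or.inl rfl),
      volume_quarterBall_eq (Or.inr rfl) (Or.inr rfl)] at hvol
    -- hvol : V + V + (V + V) ≤ 4/3 with V = volume (Q 1 1)
    by_contra h
    push Not at h
    have h4 : ENNReal.ofReal (4 / 3) < volume (Q 1 1) + volume (Q 1 1) + (volume (Q 1 1) + volume (Q 1 1)) := by
      rw [show (4 : ℝ) / 3 = (1 / 3 + 1 / 3) + (1 / 3 + 1 / 3) by norm_num,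
        ENNReal.ofReal_add (by norm_num) (by norm_num), ENNReal.ofReal_add (by norm_num) (by norm_num)]
      exact ENNReal.add_lt_add (ENNReal.add_lt_add h h) (ENNReal.add_lt_add h h)
    exact absurd hvol (not_le.2 h4)
  -- the hyperplane {w 0 = 0} is null
  set Z : Submodule ℝ (Fin 3 → ℝ) := LinearMap.ker (LinearMap.proj 0) with hZ
  have hZne : Z ≠ ⊤ := by
    intro htop
    have hmem : (Pi.single 0 (1 : ℝ) : Fin 3 → ℝ) ∈ Z := htop ▸ Submodule.mem_top
    rw [hZ, LinearMap.mem_ker, LinearMap.proj_apply, Pi.single_eq_same] at hmem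
    exact one_ne_zero hmem
  have hZnull : volume (Z : Set (Fin 3 → ℝ)) = 0 := addHaar_submodule volume Z hZne
  have hcover : {w : Fin 3 → ℝ | 0 ≤ w 0 ∧ 0 < w 1 ∧ ∑ j, |w j| ≤ 1} ⊆ Q 1 1 ∪ (Z : Set (Fin 3 → ℝ)) := by
    rintro w ⟨h0, h1, h2⟩
    rcases h0.lt_or_eq with hlt | heq
    · exact Or.inl ⟨by rw [one_mul]; exact hlt, by rw [one_mul]; exact h1, h2⟩
    · refine Or.inr ?_
      change w ∈ LinearMap.ker (LinearMap.proj 0)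
      rw [LinearMap.mem_ker, LinearMap.proj_apply, ← heq]
  calc volume {w : Fin 3 → ℝ | 0 ≤ w 0 ∧ 0 < w 1 ∧ ∑ j, |w j| ≤ 1}
      ≤ volume (Q 1 1 ∪ (Z : Set (Fin 3 → ℝ))) := measure_mono hcover
    _ ≤ volume (Q 1 1) + volume (Z : Set (Fin 3 → ℝ)) := measure_union_le _ _
    _ ≤ ENNReal.ofReal (1 / 3) := by rw [hZnull, add_zero]; exact hopen

/-! ### Step 2: the standard corner `{x₀ ≤ 2, x₀ + x₁ + |x₂| ≤ 3, 5 − ε < 2x₀ + x₁}` has volume `≤ ε³/3` -/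
/-- The standard corner is the affine image `a + L(quarter ball)` with `|det L| = ε³`, hence has volume
`≤ ε³/3`. -/
theorem volume_stdCorner_le {ε : ℝ} (hε : 0 < ε) :
    volume {x : Fin 3 → ℝ | x 0 ≤ 2 ∧ x 0 + x 1 + |x 2| ≤ 3 ∧ 5 - ε < 2 * x 0 + x 1} ≤
      ENNReal.ofReal (ε ^ 3 / 3) := by
  set M : Matrix (Fin 3) (Fin 3) ℝ := !![-ε, 0, 0; 2 * ε, ε, 0; 0, 0, ε] with hM
  set L : (Fin 3 → ℝ) →ₗ[ℝ] (Fin 3 → ℝ) := Matrix.toLin' M with hL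
  set a : Fin 3 → ℝ := ![2, 1 - ε, 0] with ha
  have hLapp : ∀ z, L z = ![-ε * z 0, 2 * ε * z 0 + ε * z 1, ε * z 2] := by
    intro z
    rw [hL, Matrix.toLin'_apply, hM]
    ext j
    fin_cases j <;> simp [Matrix.mulVec, dotProduct, Fin.sum_univ_three]
  have hdet : LinearMap.det L = -ε ^ 3 := by
    rw [hL, LinearMap.det_toLin', Matrix.det_fin_three, hM]
    simp
    ring
  set Q : Set (Fin 3 → ℝ) := {w | 0 ≤ w 0 ∧ 0 < w 1 ∧ ∑ j, |w j| ≤ 1} with hQ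
  have hsub : {x : Fin 3 → ℝ | x 0 ≤ 2 ∧ x 0 + x 1 + |x 2| ≤ 3 ∧ 5 - ε < 2 * x 0 + x 1} ⊆
      (fun w => a + w) '' (L '' Q) := by
    rintro x ⟨h0, h1, h2⟩
    set z : Fin 3 → ℝ := ![(2 - x 0) / ε, (2 * x 0 + x 1 - 5 + ε) / ε, x 2 / ε] with hz
    have hz0 : z 0 = (2 - x 0) / ε := rfl; have hz1 : z 1 = (2 * x 0 + x 1 - 5 + ε) / ε := rfl
    have hz2 : z 2 = x 2 / ε := rfl
    refine ⟨L z, ⟨z, ⟨?_, ?_, ?_⟩, rfl⟩, ?_⟩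
    · rw [hz0]; exact div_nonneg (by linarith) hε.le
    · rw [hz1]; exact div_pos (by linarith) hε
    · rw [Fin.sum_univ_three, hz0, hz1, hz2, abs_of_nonneg (div_nonneg (by linarith) hε.le),
        abs_of_pos (div_pos (by linarith) hε), abs_div, abs_of_pos hε]
      rw [← add_div, ← add_div, div_le_one hε]
      linarith
    · rw [hLapp z]
      ext j
      fin_cases j
      · show a 0 + (-ε * z 0) = x 0
        rw [hz0]; simp [ha]; field_simp; ring
      · show a 1 + (2 * ε * z 0 + ε * z 1) = x 1
        rw [hz0, hz1]; simp [ha]; field_simp; ring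
      · show a 2 + ε * z 2 = x 2
        rw [hz2]; simp [ha]; field_simp
  calc volume {x : Fin 3 → ℝ | x 0 ≤ 2 ∧ x 0 + x 1 + |x 2| ≤ 3 ∧ 5 - ε < 2 * x 0 + x 1}
      ≤ volume ((fun w => a + w) '' (L '' Q)) := measure_mono hsub
    _ = volume (L '' Q) := by rw [Set.image_add_left, measure_preimage_add]
    _ = ENNReal.ofReal |LinearMap.det L| * volume Q := addHaar_image_linearMap volume L Q
    _ ≤ ENNReal.ofReal (ε ^ 3) * ENNReal.ofReal (1 / 3) := by
        rw [hdet, abs_neg, abs_of_pos (pow_pos hε 3)]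
        gcongr
        exact volume_quarterBall_le
    _ = ENNReal.ofReal (ε ^ 3 / 3) := by
        rw [← ENNReal.ofReal_mul (pow_pos hε 3).le]; ring_nf

/-! ### Step 3: the 24 corners `{s x_{σ0} ≤ 2, s x_{σ0} + t x_{σ1} + |x_{σ2}| ≤ 3, 5 − ε < 2 s x_{σ0} + t x_{σ1}}` -/
/-- A sorted-square inequality: on `{0 ≤ c ≤ b ≤ a ≤ 2, a + b + c ≤ 3}` one has
`a² + b² + c² ≤ 2a + b` (equality at every vertex of that polytope). -/
theorem sq_sum_le_two_mul_add {a b c : ℝ} (hc0 : 0 ≤ c) (hcb : c ≤ b) (hba : b ≤ a) (ha2 : a ≤ 2)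
    (hs : a + b + c ≤ 3) : a ^ 2 + b ^ 2 + c ^ 2 ≤ 2 * a + b := by
  nlinarith [mul_nonneg hc0 (sub_nonneg.2 hcb), mul_nonneg hc0 (sub_nonneg.2 hba),
    mul_nonneg (sub_nonneg.2 hcb) (sub_nonneg.2 hba), mul_nonneg (sub_nonneg.2 ha2) (sub_nonneg.2 hba),
    mul_nonneg (sub_nonneg.2 hs) hc0, mul_nonneg (sub_nonneg.2 hs) (sub_nonneg.2 hcb),
    mul_nonneg (sub_nonneg.2 ha2) hc0, mul_nonneg (sub_nonneg.2 hs) (sub_nonneg.2 ha2)]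

/-- Three reals can be sorted by absolute value with a permutation of `Fin 3`. -/
theorem exists_perm_abs_sorted (x : Fin 3 → ℝ) :
    ∃ σ : Equiv.Perm (Fin 3), |x (σ 1)| ≤ |x (σ 0)| ∧ |x (σ 2)| ≤ |x (σ 1)| := by
  rcases le_total |x 1| |x 0| with h01 | h01 <;> rcases le_total |x 2| |x 1| with h12 | h12 <;>
    rcases le_total |x 2| |x 0| with h02 | h02
  · exact ⟨1, h01, h12⟩
  · exact ⟨1, h01, h12⟩
  · refine ⟨Equiv.swap 1 2, ?_, ?_⟩ <;> simp [Equiv.swap_apply_of_ne_of_ne]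
    · exact h02
    · exact h12
  · refine ⟨Equiv.swap 1 2 * Equiv.swap 0 1, ?_, ?_⟩ <;>
      simp [Equiv.Perm.mul_apply, Equiv.swap_apply_of_ne_of_ne] <;> assumption
  · refine ⟨Equiv.swap 0 1, ?_, ?_⟩ <;> simp [Equiv.swap_apply_of_ne_of_ne] <;> assumption
  · refine ⟨Equiv.swap 0 1 * Equiv.swap 1 2, ?_, ?_⟩ <;>
      simp [Equiv.Perm.mul_apply, Equiv.swap_apply_of_ne_of_ne] <;> assumption
  · exact ⟨1, h12.trans h02, h02.trans h01⟩
  · refine ⟨Equiv.swap 0 2, ?_, ?_⟩ <;> simp [Equiv.swap_apply_of_ne_of_ne]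
    · exact h12
    · exact h01

/-- Every corner has volume `≤ ε³/3`: it is the preimage of the standard corner under the signed
coordinate permutation `x ↦ (s x_{σ0}, t x_{σ1}, x_{σ2})`, of determinant `±1`. -/
theorem volume_corner_le (σ : Equiv.Perm (Fin 3)) {s t ε : ℝ} (hs : s = 1 ∨ s = -1)
    (ht : t = 1 ∨ t = -1) (hε : 0 < ε) :
    volume {x : Fin 3 → ℝ | s * x (σ 0) ≤ 2 ∧ s * x (σ 0) + t * x (σ 1) + |x (σ 2)| ≤ 3 ∧
      5 - ε < 2 * (s * x (σ 0)) + t * x (σ 1)} ≤ ENNReal.ofReal (ε ^ 3 / 3) := by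
  classical
  set d : Fin 3 → ℝ := ![s, t, 1] with hd
  set N : Matrix (Fin 3) (Fin 3) ℝ := σ.toPEquiv.toMatrix with hN
  set P : (Fin 3 → ℝ) →ₗ[ℝ] (Fin 3 → ℝ) := Matrix.toLin' (Matrix.diagonal d * N) with hP
  have hNapp : ∀ x r, (N.mulVec x) r = x (σ r) := by
    intro x r
    simp only [hN, Matrix.mulVec, dotProduct, PEquiv.toMatrix_apply, Equiv.toPEquiv_apply,
      Option.mem_def, Option.some.injEq]
    rw [Finset.sum_eq_single (σ r)]
    · simp
    · intro c _ hc; rw [if_neg (Ne.symm hc), zero_mul]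
    · intro h; exact absurd (Finset.mem_univ _) h
  have hPapp : ∀ x r, P x r = d r * x (σ r) := by
    intro x r
    rw [hP, Matrix.toLin'_apply, ← Matrix.mulVec_mulVec, Matrix.mulVec_diagonal, hNapp]
  have hdet : |LinearMap.det P| = 1 := by
    rw [hP, LinearMap.det_toLin', Matrix.det_mul, Matrix.det_diagonal, hN, Matrix.det_permutation,
      Fin.prod_univ_three]
    have h0 : d 0 = s := rfl; have h1 : d 1 = t := rfl; have h2 : d 2 = 1 := rfl
    rw [h0, h1, h2, abs_mul, abs_mul, abs_mul]
    have hsg : |((Equiv.Perm.sign σ : ℤˣ) : ℝ)| = 1 := by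
      rcases Int.units_eq_one_or (Equiv.Perm.sign σ) with h | h <;> rw [h] <;> simp
    rw [hsg]
    rcases hs with h | h <;> rcases ht with h' | h' <;> rw [h, h'] <;> norm_num
  have hdet0 : LinearMap.det P ≠ 0 := fun h => by rw [h, abs_zero] at hdet; exact zero_ne_one hdet
  have hpre : {x : Fin 3 → ℝ | s * x (σ 0) ≤ 2 ∧ s * x (σ 0) + t * x (σ 1) + |x (σ 2)| ≤ 3 ∧
      5 - ε < 2 * (s * x (σ 0)) + t * x (σ 1)} =
      P ⁻¹' {x : Fin 3 → ℝ | x 0 ≤ 2 ∧ x 0 + x 1 + |x 2| ≤ 3 ∧ 5 - ε < 2 * x 0 + x 1} := by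
    ext x
    simp only [Set.mem_setOf_eq, Set.mem_preimage, hPapp]
    simp [hd]
  rw [hpre, addHaar_preimage_linearMap volume hdet0, abs_inv, hdet, inv_one, ENNReal.ofReal_one, one_mul]
  exact volume_stdCorner_le hε

/-! ### Step 4: the shell `{x ∈ W | 5 − ε < Σ x_i²}` is covered by the 24 corners -/
/-- The shell of the truncated octahedron outside the ball of radius `√(5−ε)`, in coordinates
`Fin 3 → ℝ`, has volume `≤ 8ε³`. -/
theorem volume_truncOct_shell_pi_le {ε : ℝ} (hε : 0 < ε) :
    volume {x : Fin 3 → ℝ | (∀ i, |x i| ≤ 2) ∧ ∑ i, |x i| ≤ 3 ∧ 5 - ε < ∑ i, x i ^ 2} ≤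
      ENNReal.ofReal (8 * ε ^ 3) := by
  set sg : Bool → ℝ := fun b => if b then 1 else -1 with hsg
  have hsg1 : ∀ b, sg b = 1 ∨ sg b = -1 := fun b => by cases b <;> simp [hsg]
  set C : Equiv.Perm (Fin 3) × Bool × Bool → Set (Fin 3 → ℝ) := fun p =>
    {x | sg p.2.1 * x (p.1 0) ≤ 2 ∧ sg p.2.1 * x (p.1 0) + sg p.2.2 * x (p.1 1) + |x (p.1 2)| ≤ 3 ∧
      5 - ε < 2 * (sg p.2.1 * x (p.1 0)) + sg p.2.2 * x (p.1 1)} with hC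
  have hcover : {x : Fin 3 → ℝ | (∀ i, |x i| ≤ 2) ∧ ∑ i, |x i| ≤ 3 ∧ 5 - ε < ∑ i, x i ^ 2} ⊆
      ⋃ p, C p := by
    rintro x ⟨h2, h3, h5⟩
    obtain ⟨σ, h10, h21⟩ := exists_perm_abs_sorted x
    -- signs making the two leading coordinates nonnegative
    set b₀ : Bool := decide (0 ≤ x (σ 0)) with hb₀
    set b₁ : Bool := decide (0 ≤ x (σ 1)) with hb₁
    have hs : sg b₀ * x (σ 0) = |x (σ 0)| := by
      by_cases h : 0 ≤ x (σ 0)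
      · simp [hsg, hb₀, h, abs_of_nonneg h]
      · simp [hsg, hb₀, h, abs_of_neg (not_le.1 h)]
    have ht : sg b₁ * x (σ 1) = |x (σ 1)| := by
      by_cases h : 0 ≤ x (σ 1)
      · simp [hsg, hb₁, h, abs_of_nonneg h]
      · simp [hsg, hb₁, h, abs_of_neg (not_le.1 h)]
    refine Set.mem_iUnion.2 ⟨(σ, b₀, b₁), ?_⟩
    show sg b₀ * x (σ 0) ≤ 2 ∧ sg b₀ * x (σ 0) + sg b₁ * x (σ 1) + |x (σ 2)| ≤ 3 ∧
      5 - ε < 2 * (sg b₀ * x (σ 0)) + sg b₁ * x (σ 1)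
    rw [hs, ht]
    have hsum3 : ∑ i, |x i| = |x (σ 0)| + |x (σ 1)| + |x (σ 2)| := by
      rw [← Equiv.sum_comp σ (fun i => |x i|), Fin.sum_univ_three]
    have hsq3 : ∑ i, x i ^ 2 = |x (σ 0)| ^ 2 + |x (σ 1)| ^ 2 + |x (σ 2)| ^ 2 := by
      rw [← Equiv.sum_comp σ (fun i => x i ^ 2), Fin.sum_univ_three, sq_abs, sq_abs, sq_abs]
    refine ⟨h2 _, by rw [← hsum3]; exact h3, ?_⟩
    have key := sq_sum_le_two_mul_add (abs_nonneg (x (σ 2))) h21 h10 (h2 _)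
      (by rw [← hsum3]; exact h3)
    rw [← hsq3] at key
    linarith
  calc volume {x : Fin 3 → ℝ | (∀ i, |x i| ≤ 2) ∧ ∑ i, |x i| ≤ 3 ∧ 5 - ε < ∑ i, x i ^ 2}
      ≤ volume (⋃ p, C p) := measure_mono hcover
    _ ≤ ∑' p, volume (C p) := measure_iUnion_le C
    _ = ∑ p, volume (C p) := tsum_fintype _
    _ ≤ ∑ _p : Equiv.Perm (Fin 3) × Bool × Bool, ENNReal.ofReal (ε ^ 3 / 3) :=
        Finset.sum_le_sum fun p _ => volume_corner_le p.1 (hsg1 p.2.1) (hsg1 p.2.2) hε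
    _ = ENNReal.ofReal (8 * ε ^ 3) := by
        rw [Finset.sum_const, Finset.card_univ, Fintype.card_prod, Fintype.card_prod,
          Fintype.card_perm, Fintype.card_fin, Fintype.card_bool, nsmul_eq_mul]
        have h24 : ((Nat.factorial 3 * (2 * 2) : ℕ) : ℝ≥0∞) = ENNReal.ofReal 24 := by
          norm_num [Nat.factorial]
        rw [h24, ← ENNReal.ofReal_mul (by norm_num)]
        congr 1; ring

/-! ### Step 5: the Euclidean statements -/
/-- **Vertex shaving, cubic frame**: the part of the truncated octahedron `{|x_i| ≤ 2, Σ|x_i| ≤ 3}`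
(`|W| = 32`) outside the ball of radius `√(5−ε)` has volume `≤ 8ε³` (`ε > 0`). -/
theorem volume_truncOct_normSq_gt_le {ε : ℝ} (hε : 0 < ε) :
    volume {x : EuclideanSpace ℝ (Fin 3) | ((∀ i, |x i| ≤ 2) ∧ ∑ i, |x i| ≤ 3) ∧ 5 - ε < ‖x‖ ^ 2} ≤
      ENNReal.ofReal (8 * ε ^ 3) := by
  have hm : MeasurableSet
      {x : EuclideanSpace ℝ (Fin 3) | ((∀ i, |x i| ≤ 2) ∧ ∑ i, |x i| ≤ 3) ∧ 5 - ε < ‖x‖ ^ 2} := by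
    rw [Set.setOf_and]
    refine MeasurableSet.inter ?_ (isOpen_lt continuous_const (continuous_norm.pow 2)).measurableSet
    have : {x : EuclideanSpace ℝ (Fin 3) | (∀ i, |x i| ≤ 2) ∧ ∑ i, |x i| ≤ 3} = fccWulffBody :=
      fccWulffBody_eq_truncOct.symm
    rw [this, fccWulffBody]
    exact ((Set.toFinite _).isCompact_convexHull ℝ).isClosed.measurableSet
  rw [← (PiLp.volume_preserving_toLp (Fin 3)).measure_preimage hm.nullMeasurableSet]
  refine le_trans (measure_mono ?_) (volume_truncOct_shell_pi_le hε)
  rintro w ⟨⟨h2, h3⟩, h5⟩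
  refine ⟨fun i => by simpa using h2 i, by simpa using h3, ?_⟩
  rw [EuclideanSpace.real_norm_sq_eq] at h5
  simpa using h5

/-- **Vertex shaving of the crux's Wulff body `W(A)`**, any orientation `A`: for `0 < ε ≤ 5`,
`|W(A) ∖ B̄(0, √(5−ε))| ≤ 8ε³` (the body is an isometric image of the cubic truncated octahedron;
`√5` is its circumradius, attained only at the `24` vertices). -/
theorem volume_cruxWulffBody_diff_closedBall_le
    (A : EuclideanSpace ℝ (Fin 3) ≃ₗᵢ[ℝ] EuclideanSpace ℝ (Fin 3)) {ε : ℝ} (hε : 0 < ε) (hε5 : ε ≤ 5) :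
    volume ({y : EuclideanSpace ℝ (Fin 3) | ∀ ν : EuclideanSpace ℝ (Fin 3), ⟪y, ν⟫ ≤ Real.sqrt 2 / 4 *
        ∑ᶠ w ∈ {w | w ∈ fccStacking 1 (Real.sqrt (2 / 3)) ∧ ‖w‖ = 1}, |⟪w, A.symm ν⟫|} \
        closedBall (0 : EuclideanSpace ℝ (Fin 3)) (Real.sqrt (5 - ε))) ≤ ENNReal.ofReal (8 * ε ^ 3) := by
  obtain ⟨L, hL⟩ := exists_linearIsometryEquiv_unitShell_eq
  rw [cruxWulffBody_eq_image_fccWulffBody hL A]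
  set Φ : EuclideanSpace ℝ (Fin 3) ≃ₗᵢ[ℝ] EuclideanSpace ℝ (Fin 3) := L.trans A with hΦ
  set ρ : ℝ := Real.sqrt (5 - ε) with hρ
  have hball : (Φ : EuclideanSpace ℝ (Fin 3) → EuclideanSpace ℝ (Fin 3)) '' closedBall 0 ρ =
      closedBall 0 ρ := by
    have h := Φ.toIsometryEquiv.image_closedBall 0 ρ
    rw [LinearIsometryEquiv.coe_toIsometryEquiv, map_zero] at h
    exact h
  have himage : (Φ : EuclideanSpace ℝ (Fin 3) → EuclideanSpace ℝ (Fin 3)) '' fccWulffBody \ closedBall 0 ρ =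
      Φ '' (fccWulffBody \ closedBall 0 ρ) := by
    rw [Set.image_sdiff Φ.injective, hball]
  have hsub : fccWulffBody \ closedBall (0 : EuclideanSpace ℝ (Fin 3)) ρ ⊆
      {x : EuclideanSpace ℝ (Fin 3) | ((∀ i, |x i| ≤ 2) ∧ ∑ i, |x i| ≤ 3) ∧ 5 - ε < ‖x‖ ^ 2} := by
    rintro x ⟨hx, hxb⟩
    rw [fccWulffBody_eq_truncOct] at hx
    refine ⟨hx, ?_⟩
    rw [Metric.mem_closedBall, dist_zero_right, not_le] at hxb
    have hρ2 : ρ ^ 2 = 5 - ε := by rw [hρ, Real.sq_sqrt (by linarith)]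
    rw [← hρ2]
    exact pow_lt_pow_left₀ hxb (Real.sqrt_nonneg _) two_ne_zero
  have hmeas : MeasurableSet (fccWulffBody \ closedBall (0 : EuclideanSpace ℝ (Fin 3)) ρ) :=
    isCompact_fccWulffBody.measurableSet.diff isClosed_closedBall.measurableSet
  rw [himage, LinearIsometryEquiv.image_eq_preimage_symm,
    Φ.symm.measurePreserving.measure_preimage hmeas.nullMeasurableSet]
  exact (measure_mono hsub).trans (volume_truncOct_normSq_gt_le hε)

/-! ### Step 6: shaved block bodies lose at most `8ε³` of volume -/
/-- **Shaving a block body**: for every `K ⊆ W(A)` (e.g. an intersection of grain bodies) and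
`0 < ε ≤ 5`, `|K| − 8ε³ ≤ |K ∩ B̄(0, √(5−ε))|` — the body `K ∩ B̄(0, √(5−ε))` is the one to feed to
`block_wulff_le_freeEnergy` with radius `√(5−ε)` in place of `√5`. -/
theorem toReal_volume_inter_closedBall_ge
    (A : EuclideanSpace ℝ (Fin 3) ≃ₗᵢ[ℝ] EuclideanSpace ℝ (Fin 3)) {K : Set (EuclideanSpace ℝ (Fin 3))}
    (hK : K ⊆ {y : EuclideanSpace ℝ (Fin 3) | ∀ ν : EuclideanSpace ℝ (Fin 3), ⟪y, ν⟫ ≤ Real.sqrt 2 / 4 *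
        ∑ᶠ w ∈ {w | w ∈ fccStacking 1 (Real.sqrt (2 / 3)) ∧ ‖w‖ = 1}, |⟪w, A.symm ν⟫|})
    {ε : ℝ} (hε : 0 < ε) (hε5 : ε ≤ 5) :
    (volume K).toReal - 8 * ε ^ 3 ≤
      (volume (K ∩ closedBall (0 : EuclideanSpace ℝ (Fin 3)) (Real.sqrt (5 - ε)))).toReal := by
  set W : Set (EuclideanSpace ℝ (Fin 3)) := {y | ∀ ν : EuclideanSpace ℝ (Fin 3), ⟪y, ν⟫ ≤ Real.sqrt 2 / 4 *
        ∑ᶠ w ∈ {w | w ∈ fccStacking 1 (Real.sqrt (2 / 3)) ∧ ‖w‖ = 1}, |⟪w, A.symm ν⟫|} with hW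
  set B : Set (EuclideanSpace ℝ (Fin 3)) := closedBall 0 (Real.sqrt (5 - ε)) with hB
  have hWvol : volume W = ENNReal.ofReal 32 := volume_cruxWulffBody A
  have hKfin : volume K ≠ ⊤ :=
    (lt_of_le_of_lt (measure_mono hK) (by rw [hWvol]; exact ENNReal.ofReal_lt_top)).ne
  have hsplit : volume (K ∩ B) + volume (K \ B) = volume K :=
    measure_inter_add_sdiff K isClosed_closedBall.measurableSet
  have hdiff : volume (K \ B) ≤ ENNReal.ofReal (8 * ε ^ 3) :=
    (measure_mono (Set.sdiff_subset_sdiff_left hK)).trans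
      (volume_cruxWulffBody_diff_closedBall_le A hε hε5)
  have h1 : volume (K ∩ B) ≠ ⊤ := measure_ne_top_of_subset Set.inter_subset_left hKfin
  have h2 : volume (K \ B) ≠ ⊤ := measure_ne_top_of_subset Set.sdiff_subset hKfin
  have hreal := congrArg ENNReal.toReal hsplit
  rw [ENNReal.toReal_add h1 h2] at hreal
  have hdiff' : (volume (K \ B)).toReal ≤ 8 * ε ^ 3 := by
    have := ENNReal.toReal_mono ENNReal.ofReal_ne_top hdiff
    rwa [ENNReal.toReal_ofReal (by positivity)] at this
  linarith

end Summit.Ventures.Crystal3D.Theorems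

end
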